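import Summits.QuantumFields.YangMills.Theorems.FlatTubeReductionReferenceMassBounds
import HarnessLib

/-!
# The re-weighted profile `Ω̃ = Ω·(1 + β‖x‖²)^k`: the level weight `(1 + N + N_v + N_v')^k` of the reference density is dominated by the PURE KINETIC weight `(N + 1)^k`
# of the reference density of `Ω̃` — so `…ReferenceMoments.reference_moment_le` (kinetic weights only) and `…ReferenceMassBounds` (absolute masses) apply
# (route `FlatTubeReduction`, crux K1 `NearFlatRatioLaw` stmt-QuantumFields-24720; seat `ym-line-ftr-p1` g13; rate twin «ratepack-v3 / frozen fibres»; R2b1 RECORD rung — no summit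
# statement is proved here)

WHY (memo `Cruxes/NearFlatRatioLaw/Lines/ratepack-v3-frozen-g12.md` §§5.11, 6).  `…DiagonalRatioOfLevelBounds.fpBOKernel_diag_two_sided_of_levelBounds` needs ONE moment number
`∫_S ρ₁Λ⁴ ≤ Ξ∫ρ₁`, `Λ = 1 + β·kin + β‖v̂‖² + β‖v̂'‖²`.  The fibre factors are absorbed into the profile:
* `reweight` properties — `Ω̃` is measurable, non-negative, bounded by `CΩ(1 + βR²)^k` and has the support of `Ω` (`linkEmbed` is onto);
* ★★ `integral_levelWeight_le_reweighted` — `∫ ρ₁(Ω)·Λ^k dμP ≤ ∫ ρ₁(Ω̃)·(β·kin + 1)^k dμP` (pointwise `Λ ≤ (1+N)(1+N_v)(1+N_v')` and `fpTriple` is a product).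
HONEST FRAMING: bookkeeping; femto rung R2b1 (RECORD label); not infinite volume, not a gap, not Clay.  No defs, no named facts, no `sorry`.
-/

set_option autoImplicit false

noncomputable section

open MeasureTheory Filter Topology Real Set
open scoped BigOperators ENNReal
open Literature.MathematicalPhysics.QuantumFieldTheory
open Literature.MathematicalPhysics.QuantumLattice

namespace Summit.QuantumFields.YangMills.Theorems.FemtoTransferGap.RateTube

open Summit.QuantumFields.YangMills.Theorems.FemtoTransferGap
open Summit.QuantumFields.YangMills.Theorems.FemtoTransferGap.TwoLattice
open Summit.QuantumFields.YangMills.Theorems.FemtoTransferGap.TwoLattice.ConstTube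
open Summit.QuantumFields.YangMills.Theorems.FemtoTransferGap.TwoLattice.Avg
open Summit.QuantumFields.YangMills.Theorems.FemtoTransferGap.TwoLattice.Cov
open Summit.QuantumFields.YangMills.Theorems.FemtoTransferGap.TwoLattice.Stiff (LinkSpace)

variable {L : ℕ} [NeZero L]

/-! ## §1 The re-weighted profile -/

omit [NeZero L] in
/-- `linkEmbed` is onto: every `x : LinkSpace L` is `linkEmbed L (fun e a => x (e, a))`. [folklore] -/
theorem linkEmbed_curry (x : LinkSpace L) : linkEmbed L (fun e a => x (e, a)) = x := by
  ext ea; rw [linkEmbed_apply]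

/-- **Properties of `Ω̃ = Ω·(1 + β‖x‖²)^k`**: measurable, non-negative, bounded by `CΩ(1 + βR²)^k`, same support data as `Ω`. [folklore] -/
theorem reweight_props {β : ℝ} (hβ : 0 ≤ β) {Ω : LinkSpace L → ℝ} (hΩm : Measurable Ω) {CΩ : ℝ} (hCΩ : ∀ x, |Ω x| ≤ CΩ) (hΩ0 : ∀ x, 0 ≤ Ω x) {R : ℝ}
    (hΩt : ∀ v : Edge 3 L → Fin 3 → ℝ, Ω (linkEmbed L v) ≠ 0 → v ∈ capBalancedSet L ∧ ‖linkEmbed L v‖ ≤ R) (k : ℕ) :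
    Measurable (fun x : LinkSpace L => Ω x * (1 + β * ‖x‖ ^ 2) ^ k) ∧ (∀ x : LinkSpace L, 0 ≤ Ω x * (1 + β * ‖x‖ ^ 2) ^ k) ∧
      (∀ x : LinkSpace L, |Ω x * (1 + β * ‖x‖ ^ 2) ^ k| ≤ CΩ * (1 + β * R ^ 2) ^ k) ∧
      (∀ v : Edge 3 L → Fin 3 → ℝ, Ω (linkEmbed L v) * (1 + β * ‖linkEmbed L v‖ ^ 2) ^ k ≠ 0 → v ∈ capBalancedSet L ∧ ‖linkEmbed L v‖ ≤ R) := by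
  have hCΩ0 : 0 ≤ CΩ := (abs_nonneg _).trans (hCΩ 0)
  refine ⟨hΩm.mul ((measurable_const.add ((measurable_norm.pow_const 2).const_mul β)).pow_const k), fun x => mul_nonneg (hΩ0 x) (by positivity), fun x => ?_, fun v hv => ?_⟩
  · by_cases hx : Ω x = 0
    · rw [hx, zero_mul, abs_zero]; positivity
    · have hs := hΩt (fun e a => x (e, a)) (by rw [linkEmbed_curry]; exact hx)
      rw [linkEmbed_curry] at hs
      rw [abs_mul, abs_of_nonneg (by positivity : (0 : ℝ) ≤ (1 + β * ‖x‖ ^ 2) ^ k)]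
      refine mul_le_mul (hCΩ x) (pow_le_pow_left₀ (by positivity) ?_ k) (by positivity) hCΩ0
      nlinarith [mul_le_mul_of_nonneg_left (pow_le_pow_left₀ (norm_nonneg x) hs.2 2) hβ]
  · exact hΩt v (left_ne_zero_of_mul hv)

/-! ## §2 ★★ The level weight against `Ω` is a kinetic weight against `Ω̃` -/

set_option maxHeartbeats 800000 in
/-- ★★ **`∫ ρ₁(Ω)·(1 + N + N_v + N_v')^k ≤ ∫ ρ₁(Ω̃_k)·(N + 1)^k`** (`N = β·kinDefect(orthoTube 1 v, orthoTube 1 v', g)`, `N_v = β‖v̂‖²`; `ρ₁(Ω) = fpTriple β Ω (fpWeight ε) 1 1`), given the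
integrability of the right-hand side. [folklore] -/
theorem integral_levelWeight_le_reweighted {β : ℝ} (hβ : 0 ≤ β) {Ω : LinkSpace L → ℝ} (hΩ0 : ∀ x, 0 ≤ Ω x) (ε : ℝ) (k : ℕ)
    (S : Set ((Edge 3 L → Fin 3 → ℝ) × ((Edge 3 L → Fin 3 → ℝ) × (Site 3 L → SU2))))
    (hint : Integrable (fun p : (Edge 3 L → Fin 3 → ℝ) × ((Edge 3 L → Fin 3 → ℝ) × (Site 3 L → SU2)) =>
      fpTriple L β (fun x : LinkSpace L => Ω x * (1 + β * ‖x‖ ^ 2) ^ k) (fpWeight L ε) 1 1 p * (β * kinDefect L (orthoTube L 1 p.1) (orthoTube L 1 p.2.1) p.2.2 + 1) ^ k)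
      ((orthoTransverse L).prod ((orthoTransverse L).prod (gaugeMeasure L)))) :
    ∫ p in S, fpTriple L β Ω (fpWeight L ε) 1 1 p *
        (1 + β * kinDefect L (orthoTube L 1 p.1) (orthoTube L 1 p.2.1) p.2.2 + β * ‖linkEmbed L p.1‖ ^ 2 + β * ‖linkEmbed L p.2.1‖ ^ 2) ^ k
        ∂((orthoTransverse L).prod ((orthoTransverse L).prod (gaugeMeasure L))) ≤
      ∫ p, fpTriple L β (fun x : LinkSpace L => Ω x * (1 + β * ‖x‖ ^ 2) ^ k) (fpWeight L ε) 1 1 p * (β * kinDefect L (orthoTube L 1 p.1) (orthoTube L 1 p.2.1) p.2.2 + 1) ^ k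
        ∂((orthoTransverse L).prod ((orthoTransverse L).prod (gaugeMeasure L))) := by
  haveI := isFiniteMeasure_orthoTransverse L
  haveI : SecondCountableTopology SU2 := secondCountableTopology_su2
  set μP : Measure ((Edge 3 L → Fin 3 → ℝ) × ((Edge 3 L → Fin 3 → ℝ) × (Site 3 L → SU2))) := (orthoTransverse L).prod ((orthoTransverse L).prod (gaugeMeasure L)) with hμP
  -- pointwise domination
  have hpt : ∀ p : (Edge 3 L → Fin 3 → ℝ) × ((Edge 3 L → Fin 3 → ℝ) × (Site 3 L → SU2)),
      fpTriple L β Ω (fpWeight L ε) 1 1 p * (1 + β * kinDefect L (orthoTube L 1 p.1) (orthoTube L 1 p.2.1) p.2.2 + β * ‖linkEmbed L p.1‖ ^ 2 + β * ‖linkEmbed L p.2.1‖ ^ 2) ^ k ≤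
        fpTriple L β (fun x : LinkSpace L => Ω x * (1 + β * ‖x‖ ^ 2) ^ k) (fpWeight L ε) 1 1 p * (β * kinDefect L (orthoTube L 1 p.1) (orthoTube L 1 p.2.1) p.2.2 + 1) ^ k := by
    intro p
    set N := β * kinDefect L (orthoTube L 1 p.1) (orthoTube L 1 p.2.1) p.2.2 with hN
    set a := β * ‖linkEmbed L p.1‖ ^ 2 with ha
    set b := β * ‖linkEmbed L p.2.1‖ ^ 2 with hb
    have hN0 : 0 ≤ N := mul_nonneg hβ (kinDefect_nonneg _ _ _)
    have ha0 : 0 ≤ a := mul_nonneg hβ (sq_nonneg _)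
    have hb0 : 0 ≤ b := mul_nonneg hβ (sq_nonneg _)
    have hdom : (1 + N + a + b) ^ k ≤ (1 + a) ^ k * (1 + b) ^ k * (N + 1) ^ k := by
      rw [← mul_pow, ← mul_pow]
      exact pow_le_pow_left₀ (by positivity) (by nlinarith [mul_nonneg ha0 hb0, mul_nonneg ha0 hN0, mul_nonneg hb0 hN0, mul_nonneg (mul_nonneg ha0 hb0) hN0]) k
    have hK : 0 ≤ fpWeight L ε p.2.2 * transferKernel su2Rep β (orthoTube L 1 p.1) (gaugeTransform p.2.2 (orthoTube L 1 p.2.1)) :=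
      mul_nonneg (fpWeight_mem_Icc L ε _).1 (transferKernel_pos _ _ _ _).le
    unfold fpTriple
    have e : Ω (linkEmbed L p.1) * (1 + β * ‖linkEmbed L p.1‖ ^ 2) ^ k *
        (fpWeight L ε p.2.2 * transferKernel su2Rep β (orthoTube L 1 p.1) (gaugeTransform p.2.2 (orthoTube L 1 p.2.1)) *
          (Ω (linkEmbed L p.2.1) * (1 + β * ‖linkEmbed L p.2.1‖ ^ 2) ^ k)) * (N + 1) ^ k =
        Ω (linkEmbed L p.1) * (fpWeight L ε p.2.2 * transferKernel su2Rep β (orthoTube L 1 p.1) (gaugeTransform p.2.2 (orthoTube L 1 p.2.1)) * Ω (linkEmbed L p.2.1)) *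
          ((1 + a) ^ k * (1 + b) ^ k * (N + 1) ^ k) := by rw [ha, hb]; ring
    rw [e]
    exact mul_le_mul_of_nonneg_left hdom (mul_nonneg (hΩ0 _) (mul_nonneg hK (hΩ0 _)))
  have h0 : ∀ p : (Edge 3 L → Fin 3 → ℝ) × ((Edge 3 L → Fin 3 → ℝ) × (Site 3 L → SU2)),
      0 ≤ fpTriple L β (fun x : LinkSpace L => Ω x * (1 + β * ‖x‖ ^ 2) ^ k) (fpWeight L ε) 1 1 p * (β * kinDefect L (orthoTube L 1 p.1) (orthoTube L 1 p.2.1) p.2.2 + 1) ^ k := by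
    intro p
    unfold fpTriple
    have hN0 : 0 ≤ β * kinDefect L (orthoTube L 1 p.1) (orthoTube L 1 p.2.1) p.2.2 := mul_nonneg hβ (kinDefect_nonneg _ _ _)
    have h1 : 0 ≤ Ω (linkEmbed L p.1) * (1 + β * ‖linkEmbed L p.1‖ ^ 2) ^ k := mul_nonneg (hΩ0 _) (by positivity)
    have h2 : 0 ≤ Ω (linkEmbed L p.2.1) * (1 + β * ‖linkEmbed L p.2.1‖ ^ 2) ^ k := mul_nonneg (hΩ0 _) (by positivity)
    exact mul_nonneg (mul_nonneg h1 (mul_nonneg (mul_nonneg (fpWeight_mem_Icc L ε _).1 (transferKernel_pos _ _ _ _).le) h2)) (by positivity)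
  have hl0 : ∀ p : (Edge 3 L → Fin 3 → ℝ) × ((Edge 3 L → Fin 3 → ℝ) × (Site 3 L → SU2)),
      0 ≤ fpTriple L β Ω (fpWeight L ε) 1 1 p * (1 + β * kinDefect L (orthoTube L 1 p.1) (orthoTube L 1 p.2.1) p.2.2 + β * ‖linkEmbed L p.1‖ ^ 2 + β * ‖linkEmbed L p.2.1‖ ^ 2) ^ k := by
    intro p
    unfold fpTriple
    have hN0 : 0 ≤ β * kinDefect L (orthoTube L 1 p.1) (orthoTube L 1 p.2.1) p.2.2 := mul_nonneg hβ (kinDefect_nonneg _ _ _)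
    have : 0 ≤ 1 + β * kinDefect L (orthoTube L 1 p.1) (orthoTube L 1 p.2.1) p.2.2 + β * ‖linkEmbed L p.1‖ ^ 2 + β * ‖linkEmbed L p.2.1‖ ^ 2 := by positivity
    exact mul_nonneg (mul_nonneg (hΩ0 _) (mul_nonneg (mul_nonneg (fpWeight_mem_Icc L ε _).1 (transferKernel_pos _ _ _ _).le) (hΩ0 _))) (by positivity)
  calc ∫ p in S, fpTriple L β Ω (fpWeight L ε) 1 1 p *
          (1 + β * kinDefect L (orthoTube L 1 p.1) (orthoTube L 1 p.2.1) p.2.2 + β * ‖linkEmbed L p.1‖ ^ 2 + β * ‖linkEmbed L p.2.1‖ ^ 2) ^ k ∂μP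
      ≤ ∫ p in S, fpTriple L β (fun x : LinkSpace L => Ω x * (1 + β * ‖x‖ ^ 2) ^ k) (fpWeight L ε) 1 1 p * (β * kinDefect L (orthoTube L 1 p.1) (orthoTube L 1 p.2.1) p.2.2 + 1) ^ k ∂μP := by
        refine integral_mono_of_nonneg (ae_of_all _ hl0) hint.integrableOn (ae_of_all _ hpt)
    _ ≤ ∫ p, fpTriple L β (fun x : LinkSpace L => Ω x * (1 + β * ‖x‖ ^ 2) ^ k) (fpWeight L ε) 1 1 p * (β * kinDefect L (orthoTube L 1 p.1) (orthoTube L 1 p.2.1) p.2.2 + 1) ^ k ∂μP :=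
        setIntegral_le_integral hint (ae_of_all _ h0)

end Summit.QuantumFields.YangMills.Theorems.FemtoTransferGap.RateTube

end
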